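import Summits.ResolutionOfSingularities.ResolutionOfSingularities.Theorems.PurelyInseparableDim4ResConeHeavyLoseStepLetters
import Summits.ResolutionOfSingularities.ResolutionOfSingularities.Theorems.PurelyInseparableDim4ResConeHeavyLoseTail
import HarnessLib
import HarnessLib.Audit.Tags

/-!
# Purely inseparable four-folds — the HEAVY LOSE STEP WITH A FROZEN CONE SET ON A TAIL (chain dress of «L_set»), every `(p, d < p)`
# (rung-2 frame «Φ-line with a frozen cone monomial» of the K2(p) lane; cell `res-dim4-pi`)

[OURS · counted 0 · cell `res-dim4-pi` · K2(p) lane holder res-dim4-p-12 g5, HOLDER RULINGS g5-4 (5) (owners E_set p-9 · K_set p-7 · L_set p-2 ·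
α/labels p-11 · tracker_set holder); seat res-dim4-p-2 g6.]  Nothing here proves any TAIL(p, d, e), K2(7), K2(p) or resolution of
singularities in dimension ≥ 4 / characteristic `p` — NOT proved.  AI kernel work, weaker than expert review.

**`tail_heavy_lose_step_letters`** is to `heavy_lose_step_letters` (`…HeavyLoseStepLetters`) what `tail_heavy_lose_step` (p710102) is to
`heavy_lose_step` (p709039): along a witnessed isolated above-floor `Step0 p` chain with `x^{r₀} ∣ F₀`, constant shade `d < p` and `e_G ≡ 2`
from `k₀`, at `k ≥ k₀` with a letter `h` TRANSVERSAL to the step (`(direction (j k) (b k)) h ≠ 0`), a finite set `P` of CONE LETTERS OF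
`c k` (`∀ v ∈ resVertex (c k), v_z = 0`) and a SET exponent `1 ≤ m ≤ d` with `p ≤ Σ_{i ∈ insert (j k) P} r_{k+1} i + m` and
`(|r_k| + d − p) + m ≤ p`, an ENTRY frame at `k` on `h` (`pts ≠ ∅`, `d! < δs` for `(G_k)`) yields a RUN frame at `k+1` on `j k` with
`d·αs′ ≤ (m − 1)·d!`, `0 < αs′`, `βs′ ≤ βs` — every tail fact (`hF hd hdiv hpo ho2 hF' hF₁ hd₁ hndvd hbj`, the step's shade, the residual
exponent `e = p − w′ ≥ 1`) discharged by res-dim4-p-9 g5's `tail_factorisation` / `tail_step_factorisation` / `tail_weights_laws` and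
`tail_newborn_weight`.  The tracker of the rung-2 frame calls it once per LOSE edge with `m := p − w′ − W`, `W` the weight of the frozen cone
set.  `tail_heavy_lose_step` is the instance `P = ∅`, `m = p − w′`.
[cite: CossartJannsenSaito2020, Lemma 11.5, Lemma 12.1 (3), Lemma 12.2 (1), Lemma 13.6] [cite: CossartPiltant2008, Lemma 4.5 (2)] [cite: Hauser2010, §§F–G]
bears_on: LADDER-RESOLUTION:D157-DOOR2 (res-dim4-pi · K2(p) · rung-2 frame «Φ-line with a frozen cone monomial» · L_set chain dress).
Supports stmt-ResolutionOfSingularities-16155 (helper).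
-/

set_option linter.dupNamespace false -- mandated namespace of this single-conjunct summit

noncomputable section

namespace Summit.ResolutionOfSingularities.ResolutionOfSingularities.Theorems.PIDim4

namespace ResCone

open MvPolynomial Finset IsLocalRing
open Literature.AlgebraicGeometry.Resolution
open Literature.AlgebraicGeometry.Resolution.CentreBlowup
open Literature.AlgebraicGeometry.Resolution.Hauser2010
open Literature.AlgebraicGeometry.Resolution.HauserPerlega2019
open Literature.AlgebraicGeometry.Resolution.WeightedOrder
open PointBlowup (direction additiveSubspace)

variable {K : Type} [Field K] {p : ℕ} [Fact p.Prime] [CharP K p] [DecidableEq K]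

/-- **THE HEAVY LOSE STEP WITH A FROZEN CONE SET, ON A CONSTANT-SHADE TAIL** (chain dress of `heavy_lose_step_letters`).  Along a
witnessed isolated above-floor `Step0 p` chain `c j b` with `x^{r₀} ∣ F₀`, constant shade `d < p` and `e_G ≡ 2` from `k₀`, let `k ≥ k₀`, `h`
a letter TRANSVERSAL to the step, `P` a finite set of CONE LETTERS of `c k`, and `m` a SET exponent with `1 ≤ m ≤ d`,
`p ≤ Σ_{i ∈ insert (j k) P} r_{k+1} i + m` and `(|r_k| + d − p) + m ≤ p`.  Then an ENTRY frame at `k` on `h` (left inverse, `L u₁ = e_h`,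
y-rows ⟂ `resVertex (c k)`, `pts ≠ ∅`, `d! < δs` for `(G_k)`, `G_k = F_k / x^{r_k}`) yields a RUN frame at `k+1` on `j k` (y′-rows ⟂
`resVertex (c (k+1))`, `pts′ ≠ ∅`, `d! < δs′`, `d·αs′ ≤ (m − 1)·d!`, `0 < αs′`) with `βs′ ≤ βs`. [OURS]
[cite: CossartJannsenSaito2020, Lemma 12.1 (3), Lemma 12.2 (1), Lemma 13.6] [cite: CossartPiltant2008, Lemma 4.5 (2)] -/
theorem tail_heavy_lose_step_letters {d m : ℕ} (hdp : d < p) (hm1 : 1 ≤ m) (hmd : m ≤ d) {c : ℕ → State K} {j : ℕ → Fin 4}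
    {b : ℕ → Fin 4 → K}
    (hc : ∀ k, IsIsolated p (c k).F ∧ Step0 p (c k) (c (k + 1))) (hw : FreeTail.IsWitnessedChain p c j b)
    (hr0 : ∀ e ∈ (c 0).F.support, (c 0).r ≤ e) (hfloor : ∀ k, ordZero (c k).F ≠ p) {k₀ : ℕ}
    (hshade : ∀ k, k₀ ≤ k → (c k).shade = ((d : ℕ) : ℕ∞))
    (he : ∀ k, k₀ ≤ k → Module.finrank K (resVertex (c k)) = 2)
    {k : ℕ} (hk : k₀ ≤ k) {h : Fin 4} (hdirh : direction (j k) (b k) h ≠ 0)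
    (P : Finset (Fin 4)) (hPcone : ∀ z ∈ P, ∀ v ∈ resVertex (c k), v z = 0)
    (hcritT : p ≤ (∑ i ∈ insert (j k) P, (c (k + 1)).r i) + m) (hmw : (c k).r.degree + d - p + m ≤ p)
    {L : Fin (2 + 2) → Fin 4 → K} {M : Fin 4 → Fin (2 + 2) → K} (hM : ∀ t u, ∑ i, M t i * L i u = if t = u then 1 else 0)
    (hLu1 : L (u1 2) = Pi.single h 1)
    (hy : ∀ i, i ≠ u1 2 → i ≠ u2 2 → ∀ w ∈ resVertex (c k), ∑ t, L i t * w t = 0)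
    (hne : (pts (fun i => algebraMap (MvPolynomial (Fin 4) K) (OriginLocalization K 4) (∑ t, C (L i t) * X t))
      (Ideal.span {algebraMap (MvPolynomial (Fin 4) K) (OriginLocalization K 4) ((c k).F.divMonomial (c k).r)}) d).Nonempty)
    (hδ : Nat.factorial d < deltaS (fun i => algebraMap (MvPolynomial (Fin 4) K) (OriginLocalization K 4) (∑ t, C (L i t) * X t))
      (Ideal.span {algebraMap (MvPolynomial (Fin 4) K) (OriginLocalization K 4) ((c k).F.divMonomial (c k).r)}) d) :
    ∃ (L' : Fin (2 + 2) → Fin 4 → K) (M' : Fin 4 → Fin (2 + 2) → K),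
      ((∀ t u, ∑ i, M' t i * L' i u = if t = u then 1 else 0) ∧ L' (u1 2) = Pi.single (j k) 1 ∧
        (∀ i, i ≠ u1 2 → i ≠ u2 2 → ∀ w ∈ resVertex (c (k + 1)), ∑ t, L' i t * w t = 0) ∧
        (pts (fun i => algebraMap (MvPolynomial (Fin 4) K) (OriginLocalization K 4) (∑ t, C (L' i t) * X t))
          (Ideal.span {algebraMap (MvPolynomial (Fin 4) K) (OriginLocalization K 4)
            ((c (k + 1)).F.divMonomial (c (k + 1)).r)}) d).Nonempty ∧
        Nat.factorial d < deltaS (fun i => algebraMap (MvPolynomial (Fin 4) K) (OriginLocalization K 4) (∑ t, C (L' i t) * X t))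
          (Ideal.span {algebraMap (MvPolynomial (Fin 4) K) (OriginLocalization K 4)
            ((c (k + 1)).F.divMonomial (c (k + 1)).r)}) d ∧
        d * alphaS (fun i => algebraMap (MvPolynomial (Fin 4) K) (OriginLocalization K 4) (∑ t, C (L' i t) * X t))
          (Ideal.span {algebraMap (MvPolynomial (Fin 4) K) (OriginLocalization K 4)
            ((c (k + 1)).F.divMonomial (c (k + 1)).r)}) d ≤ (m - 1) * Nat.factorial d) ∧
      0 < alphaS (fun i => algebraMap (MvPolynomial (Fin 4) K) (OriginLocalization K 4) (∑ t, C (L' i t) * X t))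
          (Ideal.span {algebraMap (MvPolynomial (Fin 4) K) (OriginLocalization K 4)
            ((c (k + 1)).F.divMonomial (c (k + 1)).r)}) d ∧
      betaS (fun i => algebraMap (MvPolynomial (Fin 4) K) (OriginLocalization K 4) (∑ t, C (L' i t) * X t))
          (Ideal.span {algebraMap (MvPolynomial (Fin 4) K) (OriginLocalization K 4)
            ((c (k + 1)).F.divMonomial (c (k + 1)).r)}) d ≤
        betaS (fun i => algebraMap (MvPolynomial (Fin 4) K) (OriginLocalization K 4) (∑ t, C (L i t) * X t))
          (Ideal.span {algebraMap (MvPolynomial (Fin 4) K) (OriginLocalization K 4) ((c k).F.divMonomial (c k).r)}) d := by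
  have hk1 : k₀ ≤ k + 1 := by omega
  obtain ⟨hF, hd, hpo, ho2, hdiv⟩ := tail_factorisation hc hr0 hfloor hshade hk
  obtain ⟨hF', -⟩ := tail_step_factorisation hc hw hr0 hfloor hshade hk
  obtain ⟨hF₁, hd₁, -, -, -⟩ := tail_factorisation hc hr0 hfloor hshade hk1
  obtain ⟨-, -, -, hndvd⟩ := tail_newborn_weight hc hw hr0 hfloor hshade hk
  have hbj : b k (j k) = 0 := (hw k).2.1
  have hck1 : c (k + 1) = CentreBlowup.step p Finset.univ (j k) (b k) (c k) := (hw k).2.2.2.2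
  have hshade_eq : (CentreBlowup.step p Finset.univ (j k) (b k) (c k)).shade = (c k).shade := by
    rw [← hck1, hshade (k + 1) hk1, hshade k hk]
  -- the newborn's residual exponent `e := p − w′ ≥ 1`
  obtain ⟨e, hep⟩ : ∃ e, (c k).r.degree + d - p + e = p := ⟨p - ((c k).r.degree + d - p), by omega⟩
  exact heavy_lose_step_letters (p := p) (d := d) (e := e) (m := m) hdp (by omega) hep hm1 hmd (by omega) hpo ho2 hndvd hF hd
    hdiv hbj hF' hF₁ hd₁ (hc (k + 1)).1 hshade_eq (he k hk) (he (k + 1) hk1) (hit_of_direction_ne_zero hdirh) P hPcone hcritT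
    hM hLu1 hy hne hδ

end ResCone

end Summit.ResolutionOfSingularities.ResolutionOfSingularities.Theorems.PIDim4

end
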